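import Mathlib.Data.Matrix.Block
import Mathlib.LinearAlgebra.Matrix.Charpoly.Basic
import Mathlib.LinearAlgebra.Matrix.Reindex
import Mathlib.Topology.Instances.Matrix
import Literature.NumberTheory.GaloisRepresentations.GaloisRep
import HarnessLib

/-!
# Block (direct) sums of framed representations (trunk GalRep)

Topic `Literature/NumberTheory/GaloisRepresentations`, notion `FramedGaloisRep.blockSum` (definition
request `defn-FramedGaloisRep.blockSum`, wanted by item `InducedGaloisFamily` of route
`Langlands/TwistAveragedDeinduction`: assembling the Galois representations of the cuspidal
constituents of an isobaric automorphic representation of `GL_N(𝔸_ℚ)` into one framed representation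
of rank `N` whose Frobenius characteristic polynomial is the product).

For framed continuous representations `ρ₁ : G →ₜ* GL_m(A)`, `ρ₂ : G →ₜ* GL_n(A)` of a topological
group `G` (`Literature.NumberTheory.GaloisRepresentations.FramedRep`) the **block sum**
`ρ₁ ⊞ ρ₂ : G →ₜ* GL_{m+n}(A)` is `g ↦ diag(ρ₁ g, ρ₂ g)`, the block-diagonal matrix
`Matrix.fromBlocks (ρ₁ g) 0 0 (ρ₂ g)` on `Fin m ⊕ Fin n` relabelled to `Fin (m + n)` along Mathlib's
`finSumFinEquiv` (the first block occupies the indices `0, …, m - 1`, the second `m, …, m + n - 1`).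
It is the matrix form of the direct sum `ρ₁ ⊕ ρ₂` on `A^m ⊕ A^n` in the concatenated basis
(Serre, *Linear representations of finite groups*, §1.3 (b) direct sum; Curtis–Reiner §10).

## Main definitions

* `blockSumRingHom m n A : Matrix (Fin m) (Fin m) A × Matrix (Fin n) (Fin n) A →+* Matrix (Fin (m + n)) (Fin (m + n)) A`
  — `(M, N) ↦ diag(M, N)`.
* `glBlockSum m n A : GL (Fin m) A × GL (Fin n) A →ₜ* GL (Fin (m + n)) A` — the continuous
  block-diagonal embedding of groups (injective: `glBlockSum_injective`).
* `glReindex A e : GL ι A →ₜ* GL κ A` — relabelling along `e : ι ≃ κ` (conjugation by a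
  permutation matrix), and `FramedRep.reindex e ρ` (used to cast ranks along `Fin m ≃ Fin n`,
  e.g. `finCongr (h : m = n)`).
* `FramedRep.blockSum ρ₁ ρ₂ : FramedRep G A (m + n)` and the Galois avatar
  `FramedGaloisRep.blockSum ρ₁ ρ₂ : FramedGaloisRep K A (m + n)`.

## Main results (all proved, folklore linear algebra)

* `FramedRep.blockSum_apply_eq_one_iff` — `(ρ₁ ⊞ ρ₂)(g) = 1 ↔ ρ₁ g = 1 ∧ ρ₂ g = 1`; hence
  `FramedGaloisRep.isUnramifiedAt_blockSum_iff` — **`ρ₁ ⊞ ρ₂` is unramified at `v` iff both are**.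
* `FramedRep.charpoly_blockSum` — `charpoly (ρ₁ ⊞ ρ₂)(g) = charpoly ρ₁(g) · charpoly ρ₂(g)`
  (Mathlib `Matrix.charpoly_fromBlocks_zero₂₁`, `Matrix.charpoly_reindex`); hence
  `FramedGaloisRep.HasFrobCharpolyAt.blockSum` — **Frobenius characteristic polynomials multiply**:
  `P` on `ρ₁` and `Q` on `ρ₂` at `v` give `P * Q` on `ρ₁ ⊞ ρ₂`.
* `FramedGaloisRep.restrictField_blockSum`, `toLocal_blockSum` — **restriction to `Γ_L` (and to
  decomposition groups) commutes with block sums** (definitionally).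
* `FramedRep.trace_blockSum`, `FramedRep.det_blockSum`, `FramedRep.baseChange_blockSum`,
  `FramedRep.conj_blockSum` (a blockwise change of frame is a change of frame),
  `FramedRep.dual_blockSum`; the analogous invariance lemmas for `FramedRep.reindex`; the rank-`0`
  conventions `FramedGaloisRep.isUnramifiedAt_of_rank_zero`, `hasFrobCharpolyAt_one_of_rank_zero`
  (base case for iterated block sums over a list of constituents).

## Mathlib / tree declarations used rather than redefined

`Matrix.fromBlocks` (`fromBlocks_multiply`, `fromBlocks_one`, `fromBlocks_inj`, `fromBlocks_map`,
`fromBlocks_transpose`, `det_fromBlocks_zero₂₁`, `charpoly_fromBlocks_zero₂₁`), `Matrix.reindex`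
(`Matrix.reindexRingEquiv`, `charpoly_reindex`, `det_reindex_self`), `finSumFinEquiv`,
`Units.map`, `MulEquiv.prodUnits`, `Units.continuous_iff`, `ContinuousMonoidHom.prod`.
Mathlib has no direct sum of (continuous, framed) representations into `GL (Fin (m + n))`
(`Representation.directSum`-style constructions are unframed and carry no topology).  In the tree,
`Literature.NumberTheory.Automorphic.blockDiagGL : GL n k × GL n' k →* GL (n ⊕ n') k`
(`Automorphic/BlockDiagonalGL.lean`, field coefficients, `Sum`-indexed, no topology, heavy
algebraic-group imports) is the same matrix shape: `glBlockSum m n A (g, g')` is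
`reindex finSumFinEquiv finSumFinEquiv` of `blockDiagGL (g, g')` entrywise; it is not imported here to
keep this foundational file inside the `GaloisRep` import cone and over a general commutative
topological ring `A` (`ℤ_ℓ`, `𝒪/λⁿ`, `𝔽`).  `ReducibleGaloisRepOfCharacters.lean`
(`FramedGaloisRep.exists_sum_of_characters`) is the rank-`1 + 1` existence statement that this
construction makes explicit.

## Design notes

* The matrix-level normal form is `blockSumRingHom m n A (M, N)`: the `simp` lemmas
  `FramedRep.blockSum_apply`, `coe_glBlockSum_apply` and the four entry lemmas
  `blockSumRingHom_apply_castAdd_castAdd` / `…_natAdd_natAdd` / `…_castAdd_natAdd` /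
  `…_natAdd_castAdd` compute entries blockwise (`Fin.castAdd n i` = index `i < m` of the first
  block, `Fin.natAdd m j` = index `m + j` of the second); `blockSumRingHom_apply` (not `simp`)
  unfolds to `Matrix.reindex finSumFinEquiv finSumFinEquiv (Matrix.fromBlocks M 0 0 N)`.
  With numeral ranks (`FramedRep G A 2`, …) use `rw`: `simp` first normalises `2 + 3` to `5` in
  the index types, after which lemmas about `Fin (m + n)` no longer match syntactically.
* The rank is `m + n` (not a `Σ`/`⊕` index type) because `FramedRep G A n` is hard-wired to
  `Fin n`; iterated (isobaric) sums `ρ₁ ⊞ (ρ₂ ⊞ (… ⊞ ρ_k))` are formed by recursion over a list of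
  constituents starting from rank `0` (`isUnramifiedAt_of_rank_zero`,
  `hasFrobCharpolyAt_one_of_rank_zero`), and rank identities such as `∑ nᵢ = N` are cast with
  `FramedRep.reindex (finCongr h)` (`isUnramifiedAt_reindex_iff`, `hasFrobCharpolyAt_reindex_iff`).
* Only `[CommRing A] [TopologicalSpace A]` is assumed (no `IsTopologicalRing`, except for
  `FramedRep.det` / `FramedRep.conj` which carry it in `ContinuousRep.lean`): continuity of
  `diag(g, h)` is entrywise.

## References

* J.-P. Serre, *Linear representations of finite groups*, GTM 42 (1977), §1.3 (b) (direct sum: "the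
  matrix of `ρ_s` is `(R¹_s 0; 0 R²_s)`"), §2.1 (characters add). [SerreLinearRepresentations1977]
* J.-P. Serre, *Abelian ℓ-adic representations and elliptic curves* (1968), Ch. I §2.1, §2.3
  (unramified places, `P_{v,ρ}`). [SerreAbelianLadic1968]
-/

noncomputable section

open scoped MatrixGroups Polynomial Matrix NumberField
open Field IsDedekindDomain

namespace Literature.NumberTheory.GaloisRepresentations

universe u

/-! ### Block-diagonal matrices on `Fin (m + n)` -/

section Matrices

variable (m n : ℕ) (A : Type*) [CommRing A]

/-- `(M, N) ↦ diag(M, N) = fromBlocks M 0 0 N` on `Fin m ⊕ Fin n`, a ring homomorphism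
(Mathlib `Matrix.fromBlocks_multiply`, `fromBlocks_one`, `fromBlocks_add`). [folklore] -/
def fromBlocksRingHom :
    Matrix (Fin m) (Fin m) A × Matrix (Fin n) (Fin n) A →+*
      Matrix (Fin m ⊕ Fin n) (Fin m ⊕ Fin n) A where
  toFun MN := Matrix.fromBlocks MN.1 0 0 MN.2
  map_one' := Matrix.fromBlocks_one
  map_mul' MN MN' := by simp [Matrix.fromBlocks_multiply]
  map_zero' := Matrix.fromBlocks_zero
  map_add' MN MN' := by simp [Matrix.fromBlocks_add]

/-- **The block sum of square matrices** `(M, N) ↦ diag(M, N)`, relabelled from `Fin m ⊕ Fin n` to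
`Fin (m + n)` along `finSumFinEquiv` (`M` on the indices `< m`, `N` on the indices `≥ m`), as a ring
homomorphism (Mathlib `Matrix.reindexRingEquiv`). [folklore] -/
def blockSumRingHom :
    Matrix (Fin m) (Fin m) A × Matrix (Fin n) (Fin n) A →+* Matrix (Fin (m + n)) (Fin (m + n)) A :=
  (Matrix.reindexRingEquiv A finSumFinEquiv).toRingHom.comp (fromBlocksRingHom m n A)

variable {m n A}

/-- Unfolding lemma for `blockSumRingHom` (not `@[simp]`: `blockSumRingHom m n A (M, N)` is the
preferred normal form of a block-diagonal matrix on `Fin (m + n)`; rewrite with this lemma to reach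
Mathlib's `Matrix.reindex` / `Matrix.fromBlocks` API). [folklore] -/
theorem blockSumRingHom_apply (MN : Matrix (Fin m) (Fin m) A × Matrix (Fin n) (Fin n) A) :
    blockSumRingHom m n A MN =
      Matrix.reindex finSumFinEquiv finSumFinEquiv (Matrix.fromBlocks MN.1 0 0 MN.2) :=
  rfl

/-- Entries of `diag(M, N)` in the first diagonal block: `diag(M, N)_{i j} = M_{i j}` for
`i, j < m` (`Fin.castAdd`). [folklore] -/
@[simp] theorem blockSumRingHom_apply_castAdd_castAdd
    (MN : Matrix (Fin m) (Fin m) A × Matrix (Fin n) (Fin n) A) (i j : Fin m) :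
    blockSumRingHom m n A MN (Fin.castAdd n i) (Fin.castAdd n j) = MN.1 i j := by
  simp [blockSumRingHom_apply, Matrix.reindex_apply]

/-- Entries of `diag(M, N)` in the second diagonal block: `diag(M, N)_{m+i, m+j} = N_{i j}`
(`Fin.natAdd`). [folklore] -/
@[simp] theorem blockSumRingHom_apply_natAdd_natAdd
    (MN : Matrix (Fin m) (Fin m) A × Matrix (Fin n) (Fin n) A) (i j : Fin n) :
    blockSumRingHom m n A MN (Fin.natAdd m i) (Fin.natAdd m j) = MN.2 i j := by
  simp [blockSumRingHom_apply, Matrix.reindex_apply]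

/-- The off-diagonal blocks of `diag(M, N)` vanish (upper right). [folklore] -/
@[simp] theorem blockSumRingHom_apply_castAdd_natAdd
    (MN : Matrix (Fin m) (Fin m) A × Matrix (Fin n) (Fin n) A) (i : Fin m) (j : Fin n) :
    blockSumRingHom m n A MN (Fin.castAdd n i) (Fin.natAdd m j) = 0 := by
  simp [blockSumRingHom_apply, Matrix.reindex_apply]

/-- The off-diagonal blocks of `diag(M, N)` vanish (lower left). [folklore] -/
@[simp] theorem blockSumRingHom_apply_natAdd_castAdd
    (MN : Matrix (Fin m) (Fin m) A × Matrix (Fin n) (Fin n) A) (i : Fin n) (j : Fin m) :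
    blockSumRingHom m n A MN (Fin.natAdd m i) (Fin.castAdd n j) = 0 := by
  simp [blockSumRingHom_apply, Matrix.reindex_apply]

/-- `(M, N) ↦ diag(M, N)` is injective. [folklore] -/
theorem blockSumRingHom_injective : Function.Injective (blockSumRingHom m n A) := by
  intro MN MN' h
  rw [blockSumRingHom_apply, blockSumRingHom_apply] at h
  obtain ⟨h₁, -, -, h₂⟩ := Matrix.fromBlocks_inj.mp ((Matrix.reindex _ _).injective h)
  exact Prod.ext h₁ h₂

/-- `(M, N) ↦ diag(M, N)` is continuous (entries are entries of `M`, of `N`, or `0`). [folklore] -/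
theorem continuous_blockSumRingHom [TopologicalSpace A] : Continuous (blockSumRingHom m n A) :=
  (continuous_fst.matrix_fromBlocks continuous_const continuous_const
    continuous_snd).matrix_reindex _ _

/-- `charpoly diag(M, N) = charpoly M · charpoly N` (Mathlib `Matrix.charpoly_fromBlocks_zero₂₁`,
`Matrix.charpoly_reindex`). [folklore] -/
theorem charpoly_blockSumRingHom (MN : Matrix (Fin m) (Fin m) A × Matrix (Fin n) (Fin n) A) :
    (blockSumRingHom m n A MN).charpoly = MN.1.charpoly * MN.2.charpoly := by
  rw [blockSumRingHom_apply, Matrix.charpoly_reindex, Matrix.charpoly_fromBlocks_zero₂₁]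

/-- `det diag(M, N) = det M · det N` (Mathlib `Matrix.det_fromBlocks_zero₂₁`). [folklore] -/
theorem det_blockSumRingHom (MN : Matrix (Fin m) (Fin m) A × Matrix (Fin n) (Fin n) A) :
    (blockSumRingHom m n A MN).det = MN.1.det * MN.2.det := by
  rw [blockSumRingHom_apply, Matrix.det_reindex_self, Matrix.det_fromBlocks_zero₂₁]

/-- `tr diag(M, N) = tr M + tr N`. [folklore] -/
theorem trace_blockSumRingHom (MN : Matrix (Fin m) (Fin m) A × Matrix (Fin n) (Fin n) A) :
    (blockSumRingHom m n A MN).trace = MN.1.trace + MN.2.trace := by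
  rw [blockSumRingHom_apply, Matrix.trace, Matrix.trace, Matrix.trace]
  simp only [Matrix.diag_apply, Matrix.reindex_apply, Matrix.submatrix_apply]
  rw [Equiv.sum_comp finSumFinEquiv.symm (fun i => Matrix.fromBlocks MN.1 0 0 MN.2 i i),
    Fintype.sum_sum_type]
  simp

/-- `diag(M, N)` commutes with an entrywise change of coefficients. [folklore] -/
theorem blockSumRingHom_map {B : Type*} [CommRing B] (f : A →+* B)
    (MN : Matrix (Fin m) (Fin m) A × Matrix (Fin n) (Fin n) A) :
    (blockSumRingHom m n A MN).map f = blockSumRingHom m n B (MN.1.map f, MN.2.map f) := by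
  rw [blockSumRingHom_apply, blockSumRingHom_apply, Matrix.reindex_apply, Matrix.reindex_apply,
    ← Matrix.submatrix_map, Matrix.fromBlocks_map]
  simp only [Matrix.map_zero _ (map_zero f)]

/-- `diag(M, N)ᵀ = diag(Mᵀ, Nᵀ)`. [folklore] -/
theorem transpose_blockSumRingHom (MN : Matrix (Fin m) (Fin m) A × Matrix (Fin n) (Fin n) A) :
    (blockSumRingHom m n A MN)ᵀ = blockSumRingHom m n A (MN.1ᵀ, MN.2ᵀ) := by
  rw [blockSumRingHom_apply, blockSumRingHom_apply, Matrix.transpose_reindex,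
    Matrix.fromBlocks_transpose, Matrix.transpose_zero, Matrix.transpose_zero]

end Matrices

/-! ### The block-diagonal embedding `GL_m × GL_n →ₜ* GL_{m+n}` and relabelling of `GL` -/

section GeneralLinear

variable (m n : ℕ) (A : Type*) [CommRing A] [TopologicalSpace A]

/-- **The block-diagonal embedding of general linear groups** `(g, h) ↦ diag(g, h)`,
`GL_m(A) × GL_n(A) →ₜ* GL_{m+n}(A)` (indices relabelled along `finSumFinEquiv`), as a continuous group
homomorphism: `Units.map` of `blockSumRingHom` composed with `(M × N)ˣ ≃* Mˣ × Nˣ`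
(Mathlib `MulEquiv.prodUnits`); continuity from `Units.continuous_iff`. [folklore] -/
def glBlockSum : GL (Fin m) A × GL (Fin n) A →ₜ* GL (Fin (m + n)) A where
  toMonoidHom :=
    (Units.map (blockSumRingHom m n A).toMonoidHom).comp MulEquiv.prodUnits.symm.toMonoidHom
  continuous_toFun := by
    refine (Units.continuous_map continuous_blockSumRingHom).comp ?_
    exact Units.continuous_iff.2
      ⟨Units.continuous_val.fst'.prodMk Units.continuous_val.snd',
        Units.continuous_coe_inv.fst'.prodMk Units.continuous_coe_inv.snd'⟩

variable {m n}

/-- The matrix of `diag(g, h)` is `blockSumRingHom m n A (g, h)`. [folklore] -/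
@[simp] theorem coe_glBlockSum_apply (g : GL (Fin m) A × GL (Fin n) A) :
    ((glBlockSum m n A g : GL (Fin (m + n)) A) : Matrix (Fin (m + n)) (Fin (m + n)) A) =
      blockSumRingHom m n A ((g.1 : Matrix (Fin m) (Fin m) A), (g.2 : Matrix (Fin n) (Fin n) A)) :=
  rfl

/-- The block-diagonal embedding is injective. [folklore] -/
theorem glBlockSum_injective : Function.Injective (glBlockSum m n A) := by
  intro g g' h
  have h' := congrArg (fun u : GL (Fin (m + n)) A => (u : Matrix (Fin (m + n)) (Fin (m + n)) A)) h
  obtain ⟨h₁, h₂⟩ := Prod.ext_iff.mp (blockSumRingHom_injective h')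
  exact Prod.ext (Units.ext h₁) (Units.ext h₂)

/-- `diag(g, h) = 1 ↔ g = 1 ∧ h = 1`. [folklore] -/
theorem glBlockSum_eq_one_iff (g : GL (Fin m) A × GL (Fin n) A) :
    glBlockSum m n A g = 1 ↔ g.1 = 1 ∧ g.2 = 1 := by
  rw [map_eq_one_iff _ (glBlockSum_injective A), Prod.ext_iff, Prod.fst_one, Prod.snd_one]

/-- `det diag(g, h) = det g · det h`. [folklore] -/
theorem det_glBlockSum (g : GL (Fin m) A × GL (Fin n) A) :
    Matrix.GeneralLinearGroup.det (glBlockSum m n A g) =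
      Matrix.GeneralLinearGroup.det g.1 * Matrix.GeneralLinearGroup.det g.2 :=
  Units.ext (det_blockSumRingHom _)

/-- `diag(g, h)` commutes with a change of coefficients `Matrix.GeneralLinearGroup.map f`. [folklore] -/
theorem map_glBlockSum {B : Type*} [CommRing B] [TopologicalSpace B] (f : A →+* B)
    (g : GL (Fin m) A × GL (Fin n) A) :
    Matrix.GeneralLinearGroup.map f (glBlockSum m n A g) =
      glBlockSum m n B (Matrix.GeneralLinearGroup.map f g.1, Matrix.GeneralLinearGroup.map f g.2) :=
  Units.ext (blockSumRingHom_map f _)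

/-- Inverse-transpose commutes with `diag`: `(diag(g, h)ᵀ)⁻¹ = diag((gᵀ)⁻¹, (hᵀ)⁻¹)`. [folklore] -/
theorem glTransposeInv_glBlockSum (g : GL (Fin m) A × GL (Fin n) A) :
    glTransposeInv (Fin (m + n)) A (glBlockSum m n A g) =
      glBlockSum m n A (glTransposeInv (Fin m) A g.1, glTransposeInv (Fin n) A g.2) := by
  refine Units.ext ?_
  rw [coe_glTransposeInv_apply, ← map_inv, coe_glBlockSum_apply, coe_glBlockSum_apply,
    transpose_blockSumRingHom]
  rfl

variable {A} {ι κ : Type*} [Fintype ι] [DecidableEq ι] [Fintype κ] [DecidableEq κ]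

variable (A) in
/-- **Relabelling** `GL_ι(A) →ₜ* GL_κ(A)` along `e : ι ≃ κ`, `g ↦ reindex e e g` (conjugation by the
permutation matrix of `e`; Mathlib `Matrix.reindexRingEquiv`, `Units.map`). [folklore] -/
def glReindex (e : ι ≃ κ) : GL ι A →ₜ* GL κ A where
  toMonoidHom := Units.map (Matrix.reindexRingEquiv A e).toRingHom.toMonoidHom
  continuous_toFun := Units.continuous_map (continuous_id.matrix_reindex e e)

/-- The matrix of `glReindex A e g`. [folklore] -/
@[simp] theorem coe_glReindex_apply (e : ι ≃ κ) (g : GL ι A) :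
    ((glReindex A e g : GL κ A) : Matrix κ κ A) = Matrix.reindex e e (g : Matrix ι ι A) :=
  rfl

/-- Relabelling is injective. [folklore] -/
theorem glReindex_injective (e : ι ≃ κ) : Function.Injective (glReindex A e) := fun _ _ h =>
  Units.ext ((Matrix.reindex e e).injective (congrArg (fun u : GL κ A => (u : Matrix κ κ A)) h))

end GeneralLinear

/-! ### Block sums of framed representations of a topological group -/

namespace FramedRep

variable {G : Type*} [Group G] [TopologicalSpace G] {A : Type*} [CommRing A] [TopologicalSpace A]
  {m n : ℕ}

/-- **Block sum of framed representations**: `ρ₁ ⊞ ρ₂ : G →ₜ* GL_{m+n}(A)`, `g ↦ diag(ρ₁ g, ρ₂ g)`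
(the direct sum `ρ₁ ⊕ ρ₂` in the concatenated frame).
Ref: Serre, *Linear representations of finite groups*, §1.3 (b). [folklore] -/
def blockSum (ρ₁ : FramedRep G A m) (ρ₂ : FramedRep G A n) : FramedRep G A (m + n) :=
  (glBlockSum m n A).comp (ρ₁.prod ρ₂)

/-- Unfolding lemma for `FramedRep.blockSum`. [folklore] -/
@[simp] theorem blockSum_apply (ρ₁ : FramedRep G A m) (ρ₂ : FramedRep G A n) (g : G) :
    ρ₁.blockSum ρ₂ g = glBlockSum m n A (ρ₁ g, ρ₂ g) := rfl

/-- The matrix of `(ρ₁ ⊞ ρ₂)(g)` is `diag(ρ₁ g, ρ₂ g)` relabelled to `Fin (m + n)`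
(`blockSumRingHom`; unfold further with `blockSumRingHom_apply`). [folklore] -/
theorem coe_blockSum_apply (ρ₁ : FramedRep G A m) (ρ₂ : FramedRep G A n) (g : G) :
    ((ρ₁.blockSum ρ₂ g : GL (Fin (m + n)) A) : Matrix (Fin (m + n)) (Fin (m + n)) A) =
      blockSumRingHom m n A (((ρ₁ g : GL (Fin m) A) : Matrix (Fin m) (Fin m) A),
        ((ρ₂ g : GL (Fin n) A) : Matrix (Fin n) (Fin n) A)) :=
  rfl

/-- `(ρ₁ ⊞ ρ₂)(g) = 1 ↔ ρ₁ g = 1 ∧ ρ₂ g = 1`. [folklore] -/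
theorem blockSum_apply_eq_one_iff (ρ₁ : FramedRep G A m) (ρ₂ : FramedRep G A n) (g : G) :
    ρ₁.blockSum ρ₂ g = 1 ↔ ρ₁ g = 1 ∧ ρ₂ g = 1 := by
  rw [blockSum_apply, glBlockSum_eq_one_iff]

/-- **Characteristic polynomials multiply**: `charpoly (ρ₁ ⊞ ρ₂)(g) = charpoly ρ₁(g) · charpoly ρ₂(g)`.
Ref: Serre, *Linear representations of finite groups*, §2.1 Prop. 2 (proof). [folklore] -/
theorem charpoly_blockSum (ρ₁ : FramedRep G A m) (ρ₂ : FramedRep G A n) (g : G) :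
    (ρ₁.blockSum ρ₂).charpoly g = ρ₁.charpoly g * ρ₂.charpoly g :=
  charpoly_blockSumRingHom _

/-- **Characters add**: `tr (ρ₁ ⊞ ρ₂)(g) = tr ρ₁(g) + tr ρ₂(g)`.
Ref: Serre, *Linear representations of finite groups*, §2.1 Prop. 2 (i). [folklore] -/
theorem trace_blockSum (ρ₁ : FramedRep G A m) (ρ₂ : FramedRep G A n) (g : G) :
    (ρ₁.blockSum ρ₂).trace g = ρ₁.trace g + ρ₂.trace g :=
  trace_blockSumRingHom _

/-- `det (ρ₁ ⊞ ρ₂) = det ρ₁ · det ρ₂`. [folklore] -/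
theorem det_blockSum [IsTopologicalRing A] (ρ₁ : FramedRep G A m) (ρ₂ : FramedRep G A n) (g : G) :
    (ρ₁.blockSum ρ₂).det g = ρ₁.det g * ρ₂.det g :=
  det_glBlockSum A _

/-- Block sums commute with restriction along a continuous homomorphism `φ : H →ₜ* G`. [folklore] -/
theorem blockSum_comp {H : Type*} [Group H] [TopologicalSpace H] (ρ₁ : FramedRep G A m)
    (ρ₂ : FramedRep G A n) (φ : H →ₜ* G) :
    (ρ₁.blockSum ρ₂).comp φ = FramedRep.blockSum (ρ₁.comp φ) (ρ₂.comp φ) :=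
  ContinuousMonoidHom.ext fun _ => rfl

/-- Block sums commute with change of coefficients (`FramedRep.baseChange`). [folklore] -/
theorem baseChange_blockSum {B : Type*} [CommRing B] [TopologicalSpace B] (f : A →+* B)
    (hf : Continuous f) (ρ₁ : FramedRep G A m) (ρ₂ : FramedRep G A n) :
    (ρ₁.blockSum ρ₂).baseChange f hf = (ρ₁.baseChange f hf).blockSum (ρ₂.baseChange f hf) :=
  ContinuousMonoidHom.ext fun g => map_glBlockSum A f (ρ₁ g, ρ₂ g)

/-- A blockwise change of frame is a change of frame:
`(P ρ₁ P⁻¹) ⊞ (Q ρ₂ Q⁻¹) = diag(P, Q) (ρ₁ ⊞ ρ₂) diag(P, Q)⁻¹`. [folklore] -/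
theorem conj_blockSum [IsTopologicalRing A] (P : GL (Fin m) A) (Q : GL (Fin n) A)
    (ρ₁ : FramedRep G A m) (ρ₂ : FramedRep G A n) :
    (ρ₁.conj P).blockSum (ρ₂.conj Q) = (ρ₁.blockSum ρ₂).conj (glBlockSum m n A (P, Q)) := by
  refine ContinuousMonoidHom.ext fun g => ?_
  rw [blockSum_apply, conj_apply, conj_apply, conj_apply, blockSum_apply, ← map_inv, ← map_mul,
    ← map_mul, Prod.inv_mk, Prod.mk_mul_mk, Prod.mk_mul_mk]

/-- The dual of a block sum is the block sum of the duals. [folklore] -/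
theorem dual_blockSum (ρ₁ : FramedRep G A m) (ρ₂ : FramedRep G A n) :
    (ρ₁.blockSum ρ₂).dual = ρ₁.dual.blockSum ρ₂.dual :=
  ContinuousMonoidHom.ext fun g => glTransposeInv_glBlockSum A (ρ₁ g, ρ₂ g)

/-- **Relabelling of a framed representation** along `e : Fin m ≃ Fin n` (so `m = n`; e.g.
`e = finCongr h` casts the rank along `h : m = n`): `g ↦ reindex e e (ρ g)`, a change of frame by a
permutation matrix. [folklore] -/
def reindex (e : Fin m ≃ Fin n) (ρ : FramedRep G A m) : FramedRep G A n :=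
  (glReindex A e).comp ρ

/-- The matrix of `(ρ.reindex e)(g)`. [folklore] -/
@[simp] theorem coe_reindex_apply (e : Fin m ≃ Fin n) (ρ : FramedRep G A m) (g : G) :
    ((ρ.reindex e g : GL (Fin n) A) : Matrix (Fin n) (Fin n) A) =
      Matrix.reindex e e ((ρ g : GL (Fin m) A) : Matrix (Fin m) (Fin m) A) :=
  rfl

/-- `(ρ.reindex e)(g) = 1 ↔ ρ g = 1`. [folklore] -/
theorem reindex_apply_eq_one_iff (e : Fin m ≃ Fin n) (ρ : FramedRep G A m) (g : G) :
    ρ.reindex e g = 1 ↔ ρ g = 1 :=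
  map_eq_one_iff (glReindex A e) (glReindex_injective e)

/-- Relabelling does not change characteristic polynomials (Mathlib `Matrix.charpoly_reindex`).
[folklore] -/
theorem charpoly_reindex (e : Fin m ≃ Fin n) (ρ : FramedRep G A m) (g : G) :
    (ρ.reindex e).charpoly g = ρ.charpoly g :=
  Matrix.charpoly_reindex e _

/-- Relabelling commutes with restriction along `φ : H →ₜ* G`. [folklore] -/
theorem reindex_comp {H : Type*} [Group H] [TopologicalSpace H] (e : Fin m ≃ Fin n)
    (ρ : FramedRep G A m) (φ : H →ₜ* G) :
    (ρ.reindex e).comp φ = FramedRep.reindex e (ρ.comp φ) :=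
  ContinuousMonoidHom.ext fun _ => rfl

/-- In rank `0` every characteristic polynomial is `1` (empty determinant). [folklore] -/
theorem charpoly_of_rank_zero (ρ : FramedRep G A 0) (g : G) : ρ.charpoly g = 1 :=
  Matrix.det_isEmpty

end FramedRep

/-! ### Block sums of framed Galois representations -/

namespace FramedGaloisRep

variable {K : Type u} [Field K] {A : Type*} [CommRing A] [TopologicalSpace A] {m n : ℕ}

/-- **Block sum of framed Galois representations** `ρ₁ ⊞ ρ₂ : Γ_K →ₜ* GL_{m+n}(A)`,
`σ ↦ diag(ρ₁ σ, ρ₂ σ)` (`FramedRep.blockSum` for `G = Γ_K`): the direct sum `ρ₁ ⊕ ρ₂` in the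
concatenated frame.  Ref: Serre, *Linear representations of finite groups*, §1.3 (b); Serre,
*Abelian ℓ-adic representations* (1968), Ch. I §2.3. [folklore] -/
abbrev blockSum (ρ₁ : FramedGaloisRep K A m) (ρ₂ : FramedGaloisRep K A n) :
    FramedGaloisRep K A (m + n) :=
  FramedRep.blockSum ρ₁ ρ₂

/-- `FramedGaloisRep.blockSum` is `FramedRep.blockSum`. [folklore] -/
theorem blockSum_def (ρ₁ : FramedGaloisRep K A m) (ρ₂ : FramedGaloisRep K A n) :
    ρ₁.blockSum ρ₂ = FramedRep.blockSum ρ₁ ρ₂ := rfl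

/-- **Restriction to `Γ_L` commutes with block sums**: `(ρ₁ ⊞ ρ₂)|_{Γ_L} = ρ₁|_{Γ_L} ⊞ ρ₂|_{Γ_L}`.
[folklore] -/
theorem restrictField_blockSum (L : Type*) [Field L] [Algebra K L] (ρ₁ : FramedGaloisRep K A m)
    (ρ₂ : FramedGaloisRep K A n) :
    (ρ₁.blockSum ρ₂).restrictField L = (ρ₁.restrictField L).blockSum (ρ₂.restrictField L) :=
  ContinuousMonoidHom.ext fun _ => rfl

/-- The local representation of a block sum at an infinite place is the block sum of the local
representations. [folklore] -/
theorem toInfinite_blockSum (w : NumberField.InfinitePlace K) (ρ₁ : FramedGaloisRep K A m)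
    (ρ₂ : FramedGaloisRep K A n) :
    (ρ₁.blockSum ρ₂).toInfinite w = (ρ₁.toInfinite w).blockSum (ρ₂.toInfinite w) :=
  ContinuousMonoidHom.ext fun _ => rfl

/-- The local representation of a block sum at a finite place is the block sum of the local
representations. [folklore] -/
theorem toLocal_blockSum [NumberField K] (v : HeightOneSpectrum (𝓞 K))
    (ρ₁ : FramedGaloisRep K A m) (ρ₂ : FramedGaloisRep K A n) :
    (ρ₁.blockSum ρ₂).toLocal v = (ρ₁.toLocal v).blockSum (ρ₂.toLocal v) :=
  ContinuousMonoidHom.ext fun _ => rfl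

/-- **A block sum is unramified at `v` iff both summands are.**
Ref: Serre, *Abelian ℓ-adic representations* (1968), Ch. I §2.1. [folklore] -/
theorem isUnramifiedAt_blockSum_iff (v : HeightOneSpectrum (𝓞 K)) (ρ₁ : FramedGaloisRep K A m)
    (ρ₂ : FramedGaloisRep K A n) :
    (ρ₁.blockSum ρ₂).IsUnramifiedAt v ↔ ρ₁.IsUnramifiedAt v ∧ ρ₂.IsUnramifiedAt v := by
  simp only [IsUnramifiedAt, FramedRep.blockSum_apply_eq_one_iff]
  exact ⟨fun h => ⟨fun 𝔓 h𝔓 σ hσ => (h 𝔓 h𝔓 σ hσ).1, fun 𝔓 h𝔓 σ hσ => (h 𝔓 h𝔓 σ hσ).2⟩,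
    fun h 𝔓 h𝔓 σ hσ => ⟨h.1 𝔓 h𝔓 σ hσ, h.2 𝔓 h𝔓 σ hσ⟩⟩

/-- The block sum of two representations unramified at `v` is unramified at `v`. [folklore] -/
theorem IsUnramifiedAt.blockSum {v : HeightOneSpectrum (𝓞 K)} {ρ₁ : FramedGaloisRep K A m}
    {ρ₂ : FramedGaloisRep K A n} (h₁ : ρ₁.IsUnramifiedAt v) (h₂ : ρ₂.IsUnramifiedAt v) :
    (ρ₁.blockSum ρ₂).IsUnramifiedAt v :=
  (isUnramifiedAt_blockSum_iff v ρ₁ ρ₂).2 ⟨h₁, h₂⟩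

/-- **Frobenius characteristic polynomials of a block sum multiply**: if every arithmetic Frobenius
at `v` has characteristic polynomial `P` on `ρ₁` and `Q` on `ρ₂`, it has characteristic polynomial
`P * Q` on `ρ₁ ⊞ ρ₂`.  Ref: Serre, *Abelian ℓ-adic representations* (1968), Ch. I §2.3. [folklore] -/
theorem HasFrobCharpolyAt.blockSum {v : HeightOneSpectrum (𝓞 K)} {ρ₁ : FramedGaloisRep K A m}
    {ρ₂ : FramedGaloisRep K A n} {P Q : A[X]} (h₁ : ρ₁.HasFrobCharpolyAt v P)
    (h₂ : ρ₂.HasFrobCharpolyAt v Q) : (ρ₁.blockSum ρ₂).HasFrobCharpolyAt v (P * Q) :=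
  fun 𝔓 h𝔓 σ hσ => by rw [FramedRep.charpoly_blockSum, h₁ 𝔓 h𝔓 σ hσ, h₂ 𝔓 h𝔓 σ hσ]

/-- `det (ρ₁ ⊞ ρ₂)(σ) = det ρ₁(σ) · det ρ₂(σ)` (e.g. for parity `IsOdd` / `IsEven` bookkeeping).
[folklore] -/
theorem det_blockSum_apply (ρ₁ : FramedGaloisRep K A m) (ρ₂ : FramedGaloisRep K A n)
    (σ : absoluteGaloisGroup K) :
    Matrix.GeneralLinearGroup.det (ρ₁.blockSum ρ₂ σ) =
      Matrix.GeneralLinearGroup.det (ρ₁ σ) * Matrix.GeneralLinearGroup.det (ρ₂ σ) :=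
  det_glBlockSum A _

/-- Relabelling (`FramedRep.reindex`, e.g. a rank cast `finCongr h`) preserves unramifiedness.
[folklore] -/
theorem isUnramifiedAt_reindex_iff (v : HeightOneSpectrum (𝓞 K)) (e : Fin m ≃ Fin n)
    (ρ : FramedGaloisRep K A m) :
    IsUnramifiedAt v (FramedRep.reindex e ρ) ↔ ρ.IsUnramifiedAt v :=
  forall₂_congr fun _ _ => forall₂_congr fun σ _ => FramedRep.reindex_apply_eq_one_iff e ρ σ

/-- Relabelling preserves Frobenius characteristic polynomials. [folklore] -/
theorem hasFrobCharpolyAt_reindex_iff (v : HeightOneSpectrum (𝓞 K)) (e : Fin m ≃ Fin n)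
    (ρ : FramedGaloisRep K A m) (P : A[X]) :
    HasFrobCharpolyAt v P (FramedRep.reindex e ρ) ↔ ρ.HasFrobCharpolyAt v P := by
  refine forall₂_congr fun 𝔓 _ => forall₂_congr fun σ _ => ?_
  rw [FramedRep.charpoly_reindex]

/-- Relabelling commutes with restriction to `Γ_L`. [folklore] -/
theorem restrictField_reindex (L : Type*) [Field L] [Algebra K L] (e : Fin m ≃ Fin n)
    (ρ : FramedGaloisRep K A m) :
    restrictField L (FramedRep.reindex e ρ) = FramedRep.reindex e (ρ.restrictField L) :=
  ContinuousMonoidHom.ext fun _ => rfl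

/-- Rank `0`: every framed Galois representation of rank `0` is unramified everywhere
(`GL_0(A)` is trivial) — the base case of iterated block sums. [folklore] -/
theorem isUnramifiedAt_of_rank_zero (v : HeightOneSpectrum (𝓞 K)) (ρ : FramedGaloisRep K A 0) :
    ρ.IsUnramifiedAt v :=
  fun _ _ σ _ => Subsingleton.elim (ρ σ) 1

/-- Rank `0`: the Frobenius characteristic polynomial of a rank-`0` representation is `1` at every
place — the base case of iterated block sums. [folklore] -/
theorem hasFrobCharpolyAt_one_of_rank_zero (v : HeightOneSpectrum (𝓞 K))
    (ρ : FramedGaloisRep K A 0) : ρ.HasFrobCharpolyAt v 1 :=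
  fun _ _ σ _ => FramedRep.charpoly_of_rank_zero ρ σ

end FramedGaloisRep

end Literature.NumberTheory.GaloisRepresentations
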